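import Summits.QuantumFields.YangMills.Theorems.AlphaInputsT3ACv3CoreNonemptyE
import Summits.QuantumFields.YangMills.Theorems.AlphaInputsT3ACMinimiserPinKnitRec
import HarnessLib

/-!
# `AlphaInputsT3ACv3DataSchemaLC` — STRATEGY B for 2′: THE KNIT WITH (D6L) REPLACED BY ITS **CHARGED HALF**, the uncharged half being a theorem (`…CoreNonemptyE`) whose
# two constants side conditions are RECORD SIZES (`7L + 3 ≤ M₁` gives (N2′); `1 ≤ 2B₃ ∧ 4B₃L²·avgWindowFactor ≤ C68` gives `4π ≤ C68`) — lane `pub-balaban3d`, seat alpha-2 (g3)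

WHAT (definition-free).  §1 ★ `adaptedClassNonemptyT3L_of_charged_of_collar`: (D6L) `AdaptedClassNonemptyT3L` ⇐ (N2′) `CollarE (T3Scales …) 𝔠 K` ∧ `4π ≤ C68` ∧ ITS CHARGED
HALF «for every admissible non-trivial `h` and every CHARGED datum `W` ((40)-window inside `Ω_k(h)`), `𝒞_L(k, h, W) ≠ ∅» (stated inline; the uncharged case is
`adaptedClassT3L_nonempty_of_not_charged_of_collar`); the two constants conditions from record sizes: `collarE_T3_of_M₁_ge` (`7L + 3 ≤ M₁ ⇒ (N2′)` for every coupling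
of the window and every run: `⌈R₁r(g_j)⌉ ≥ 6`), `four_pi_le_C68_of_sizes` (`1 ≤ 2B₃`, `4B₃L²·avgWindowFactor(L) ≤ C68 ⇒ 4π ≤ 302 ≤ C68`).  §2 ★★ `ofV3At_of_pinnedRowsLC` —
the OWNER's DEPMAP v3.1 knit `ofV3At_of_pinnedRowsL` with `hD6L` REPLACED by `hM₁ : 7L + 3 ≤ 𝔠.M₁` and the charged half `hD6C`; `dataSchemaT3ACL_of_pinnedRows₂C` ∕
`ofV3At_of_pinnedRows₂C` — the same with lane A's closed-form sizes and the print-strength data row (O″).  §3 ★ `exists_record_sizes_M₁`: records with exact profile, all three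
`C68`-sizes AND `7L + 3 ≤ M₁` exist beyond a threshold (the new size row costs the data provider nothing).
CAVEAT (HOME memo `D6L-STATUS-alpha2-g3.md`).  The charged half over the CURRENT class (conjunct `regClassC`: every fine plaquette with a corner in `Ω_j(h)`, `j < k`, so ALL fine
plaquettes at `j = 0`) is NOT expected to be dischargeable: for a history whose large-field plaquettes form a tube around a torus cycle and a charged `W` flat on `Ω_k(h)` with
holonomy `−1` around the tube, no globally-small `U` has `k`-fold average `W` (lattice Stokes); the memo proposes re-cutting the class to the LOCAL (68) sets the rows read.
HONEST FRAMING.  Bookkeeping around displayed rows; (T) `Thm1GlobalMinAt`, the CHARGED half of (D6L) and the data rows (O) stay hypotheses; nothing of [B10]∕[7]∕[4]'s estimates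
asserted; count-neutral helper toward R3 2′ (`stub_laneRecordsV3`, items 19935∕19936); registry untouched; nothing about d = 4, the continuum, or a mass gap.

References: T. Bałaban, Commun. Math. Phys. 102 (1985) 255–275 [Balaban1985UV3] ((7) p.257, (39)–(42) p.266, (67)–(68) p.273, Thm 2 p.272); CMP 102 (1985) 277–309
[Balaban1985Variational] (Thm 1 (8) p.279); CMP 98 (1985) 17–51 [Balaban1985Averaging] (Prop. 2 p.26).
-/

set_option autoImplicit false

noncomputable section

namespace Summit.QuantumFields.YangMills.Theorems

open MeasureTheory Set
open scoped Matrix.Norms.L2Operator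
open Literature.MathematicalPhysics.QuantumFieldTheory.Balaban1983to89
open Literature.MathematicalPhysics.QuantumFieldTheory.Balaban1983to89.B10 (pFun rFun)
open Literature.MathematicalPhysics.QuantumFieldTheory.Balaban1983to89.B10LargeField (xlog one_le_xlog rFun_eq)
open Literature.MathematicalPhysics.QuantumFieldTheory.Balaban1983to89.T3ContinuumYM3Torus
open Literature.MathematicalPhysics.QuantumFieldTheory.Balaban1983to89.T3UnitScaleTilt (θBal)
open Literature.MathematicalPhysics.QuantumFieldTheory.Balaban1983to89.T3PrintedMinimiserExistence (Thm1GlobalMinAt)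
open Literature.MathematicalPhysics.QuantumFieldTheory.Balaban1983to89.ExpMeanLog (deltaSU)
open Literature.MathematicalPhysics.QuantumFieldTheory.Balaban1985CMP102.Setting
open Summit.QuantumFields.Balaban3D.Carriers
open Summit.QuantumFields.Balaban3D.Proofs.Primitives
open Summit.QuantumFields.Balaban3D.Proofs.ScalesArithmetic (gk_pos gk_le_one)
open Summit.QuantumFields.Balaban3D.Proofs.Thresholds (Q0 Q0_pos)
open Summit.QuantumFields.YangMills.Theorems.BalabanUVNodesN08AlphaProfileBuild (R0)
open Summit.QuantumFields.YangMills.Theorems.ProfileEnlarged (CollarE)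
open B7Prop2Explicit (C0 C0_pos)

/-! ## §1 (D6L) from its charged half and the collar; the constants conditions from record sizes -/

section Charged

variable {F : T3Family} {𝔠 : AlphaConsts F.L (suGroupModel 2).N} {γ : ℝ} {hγ : 0 < γ} {hγ1 : γ ≤ (min 𝔠.gamma0 1) ^ 2} {K : ℕ}

/-- **★ (D6L) FROM ITS CHARGED HALF, THE COLLAR ROW (N2′) AND `4π ≤ C68`** (the uncharged case is `adaptedClassT3L_nonempty_of_not_charged_of_collar`).
[cite: Balaban1985UV3, (40)–(42) p.266 + (67)–(68) p.273] -/
theorem AlphaInputsT3AC.adaptedClassNonemptyT3L_of_charged_of_collar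
    (hN2 : CollarE (T3Scales F γ hγ (hγ1.trans (sq_min_one_le _ 𝔠.gamma0_pos)) K) 𝔠 K) (hC : 4 * Real.pi ≤ 𝔠.C68)
    (h6 : (∀ (k : ℕ), k ≤ K → ∀ (h : Hist (F.P K) k),
      Hist.Admissible 𝔠.lane.carrier.M₁ (rcolOf (T3Scales F γ hγ (hγ1.trans (sq_min_one_le _ 𝔠.gamma0_pos)) K) 𝔠.lane.carrier) k h →
      h ≠ Hist.triv (F.P K) k → ∀ (W : GaugeField (F.P K) k (Matrix.specialUnitaryGroup (Fin 2) ℂ)),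
        ChargedT3 F γ 𝔠.b₀ 𝔠.p₀ (avgWindowFactor F.L) K 𝔠.lane.carrier.M₁
          (rcolOf (T3Scales F γ hγ (hγ1.trans (sq_min_one_le _ 𝔠.gamma0_pos)) K) 𝔠.lane.carrier) k h W →
        (AlphaInputsT3AC.adaptedClassT3L F 𝔠 γ hγ hγ1 K k h W).Nonempty)) :
    AlphaInputsT3AC.AdaptedClassNonemptyT3L F 𝔠 γ hγ hγ1 K := by
  intro k hk h hh ht W
  by_cases hW : ChargedT3 F γ 𝔠.b₀ 𝔠.p₀ (avgWindowFactor F.L) K 𝔠.lane.carrier.M₁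
      (rcolOf (T3Scales F γ hγ (hγ1.trans (sq_min_one_le _ 𝔠.gamma0_pos)) K) 𝔠.lane.carrier) k h W
  · exact h6 k hk h hh ht W hW
  · exact AlphaInputsT3AC.adaptedClassT3L_nonempty_of_not_charged_of_collar hN2 hC hk hh W hW

/-- **THE COLLAR ROW (N2′) FROM THE BIG-BLOCK SIZE `7L + 3 ≤ M₁`** (every coupling of the window, every run): `Rcol_j = ⌈R₁r(g_j)⌉M₁ ≥ 6M₁ ≥ 42L + 18` since `R₁ ≥ 6` and
`r(g_j) = (1 + log g_j⁻¹)^{r₀} ≥ 1` (`g_j ≤ 1`). [cite: Balaban1985UV3, (7) p.257 + (39) p.266] -/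
theorem AlphaInputsT3AC.collarE_T3_of_M₁_ge (hM : 7 * F.L + 3 ≤ 𝔠.M₁) : CollarE (T3Scales F γ hγ (hγ1.trans (sq_min_one_le _ 𝔠.gamma0_pos)) K) 𝔠 K := by
  intro j hj
  set S : Scales F.L := T3Scales F γ hγ (hγ1.trans (sq_min_one_le _ 𝔠.gamma0_pos)) K with hS
  have hg := gk_pos S j
  have hg1 : S.gk j ≤ 1 := gk_le_one S S.gK_le_one j (show j ≤ K by omega)
  have hx : 1 ≤ xlog (S.gk j) := one_le_xlog hg hg1
  have hr : 1 ≤ rFun 𝔠.r₀ (S.gk j) := by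
    rw [rFun_eq]
    exact Real.one_le_rpow hx (by linarith [𝔠.one_le_r₀])
  have hR₁ : (6 : ℝ) ≤ 𝔠.R₁ := by have := 𝔠.R₁_ge; have := 𝔠.κ₀_pos; linarith
  have h6 : (6 : ℝ) ≤ 𝔠.R₁ * rFun 𝔠.r₀ (S.gk j) := by nlinarith
  have hceil : 6 ≤ ⌈𝔠.R₁ * rFun 𝔠.r₀ (S.gk j)⌉₊ := by
    have := h6.trans (Nat.le_ceil (𝔠.R₁ * rFun 𝔠.r₀ (S.gk j)))
    exact_mod_cast this
  show 39 * F.L + R0 + 8 ≤ ⌈𝔠.R₁ * rFun 𝔠.r₀ (S.gk j)⌉₊ * 𝔠.M₁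
  calc 39 * F.L + R0 + 8 ≤ 6 * (7 * F.L + 3) := by norm_num [R0]; omega
    _ ≤ ⌈𝔠.R₁ * rFun 𝔠.r₀ (S.gk j)⌉₊ * 𝔠.M₁ := Nat.mul_le_mul hceil hM

/-- **`4π ≤ C68` FROM THE RECORD'S SIZES** `1 ≤ 2B₃`, `4B₃L²·avgWindowFactor(L) ≤ C68` (`avgWindowFactor(L) = 151L² ≥ 151`, so `C68 ≥ 302 > 4π`). [folklore] -/
theorem AlphaInputsT3AC.four_pi_le_C68_of_sizes (hB₃ : 1 ≤ 2 * 𝔠.B₃) (hC : 4 * 𝔠.B₃ * (F.L : ℝ) ^ 2 * avgWindowFactor F.L ≤ 𝔠.C68) : 4 * Real.pi ≤ 𝔠.C68 := by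
  have hL1 : (1 : ℝ) ≤ F.L := by exact_mod_cast le_of_lt F.hL.2
  have hL2 : (1 : ℝ) ≤ (F.L : ℝ) ^ 2 := one_le_pow₀ hL1
  have hw : avgWindowFactor F.L = 151 * (F.L : ℝ) ^ 2 := by
    unfold avgWindowFactor; push_cast; ring
  have hpi := Real.pi_lt_d2
  have hB : (1 : ℝ) / 2 ≤ 𝔠.B₃ := by linarith
  have h1 : (302 : ℝ) ≤ 4 * 𝔠.B₃ * (F.L : ℝ) ^ 2 * avgWindowFactor F.L := by
    rw [hw]
    have h2 : (1 : ℝ) ≤ (F.L : ℝ) ^ 2 * (F.L : ℝ) ^ 2 := by nlinarith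
    nlinarith
  linarith

end Charged

/-! ## §2 The knit with (D6L) replaced by `7L + 3 ≤ M₁` and the charged row -/

section Knit

open Literature.MathematicalPhysics.QuantumFieldTheory.Balaban1983to89.T3Thresholds (sqrt_le_exp_iff)

variable (F : T3Family) (𝔠 : AlphaConsts F.L (suGroupModel 2).N)

/-- ★★ **THE v3 (α) PACKAGE FROM [7] THM 1 + SIZE CONDITIONS (incl. `7L + 3 ≤ M₁`) + (D6L-CHARGED) + THE DATA ROWS (O∀)** — the OWNER's DEPMAP v3.1 knit
`ofV3At_of_pinnedRowsL` with `hD6L` supplied by `adaptedClassNonemptyT3L_of_charged_of_collar` ((N2′) ⇐ `collarE_T3_of_M₁_ge`, `4π ≤ C68` ⇐ `four_pi_le_C68_of_sizes`).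
[cite: Balaban1985UV3, Thm 2 p.272 + (40)–(42) p.266 + (67)–(68) p.273; Balaban1985Variational, Thm 1 (8) p.279] -/
theorem AlphaInputsT3AC.ofV3At_of_pinnedRowsLC {a₀ a₁ : ℝ}
    (hT : Thm1GlobalMinAt F.L a₀ a₁ 𝔠.B₃) (hwin : 𝔠.B₃ * a₁ ≤ a₀)
    (hA3 : (143 * ((((3 + 4 : ℕ) : ℝ)) ^ 2 / 4) ^ 2) * (2 * (𝔠.B₃ * a₁)) ≤ 1 / 3)
    (hA2 : 2 * (2 * (𝔠.B₃ * a₁)) ≤ 2 * deltaSU (Fin 2) / (((3 + 4) * F.L : ℕ) : ℝ) ^ 2)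
    (hB₃ : 1 ≤ 2 * 𝔠.B₃) (hC : 4 * 𝔠.B₃ * (F.L : ℝ) ^ 2 * avgWindowFactor F.L ≤ 𝔠.C68)
    (hanti : (min 𝔠.gamma0 1) ^ 2 ≤ Real.exp (2 * (1 - 𝔠.p₀)))
    (hsmall : ∀ γ : ℝ, 0 < γ → γ ≤ (min 𝔠.gamma0 1) ^ 2 →
      ∀ K k : ℕ, 2 * (F.L : ℝ) ^ 2 * avgWindowFactor F.L * θBal F.L γ 𝔠.b₀ 𝔠.p₀ (K - k + 1) ≤ a₁)
    (hM₁ : 7 * F.L + 3 ≤ 𝔠.M₁)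
    (hD6C : ∀ (γ : ℝ) (hγ : 0 < γ) (hγ1 : γ ≤ (min 𝔠.gamma0 1) ^ 2) (K : ℕ),
      (∀ (k : ℕ), k ≤ K → ∀ (h : Hist (F.P K) k),
        Hist.Admissible 𝔠.lane.carrier.M₁ (rcolOf (T3Scales F γ hγ (hγ1.trans (sq_min_one_le _ 𝔠.gamma0_pos)) K) 𝔠.lane.carrier) k h →
        h ≠ Hist.triv (F.P K) k → ∀ (W : GaugeField (F.P K) k (Matrix.specialUnitaryGroup (Fin 2) ℂ)),
          ChargedT3 F γ 𝔠.b₀ 𝔠.p₀ (avgWindowFactor F.L) K 𝔠.lane.carrier.M₁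
            (rcolOf (T3Scales F γ hγ (hγ1.trans (sq_min_one_le _ 𝔠.gamma0_pos)) K) 𝔠.lane.carrier) k h W →
          (AlphaInputsT3AC.adaptedClassT3L F 𝔠 γ hγ hγ1 K k h W).Nonempty))
    (hrows : ∀ (γ : ℝ) (hγ : 0 < γ) (hγ1 : γ ≤ (min 𝔠.gamma0 1) ^ 2) (K : ℕ)
      (Ut : (k : ℕ) → GaugeField (F.P K) k (Matrix.specialUnitaryGroup (Fin 2) ℂ) → GaugeField (F.P K) 0 (Matrix.specialUnitaryGroup (Fin 2) ℂ)),
      AlphaInputsT3AC.TrivMinimiserRowsT3 F 𝔠 γ hγ hγ1 a₀ a₁ K Ut → AlphaInputsT3AC.DataRowsT3L F 𝔠 γ hγ hγ1 K Ut) :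
    AlphaInputsT3AC.OfV3At F 𝔠 a₀ a₁ :=
  AlphaInputsT3AC.ofV3At_of_pinnedRowsL F 𝔠 hT hwin hA3 hA2 hB₃ hC hanti hsmall
    (fun γ hγ hγ1 K => AlphaInputsT3AC.adaptedClassNonemptyT3L_of_charged_of_collar
      (AlphaInputsT3AC.collarE_T3_of_M₁_ge (hγ := hγ) (hγ1 := hγ1) (K := K) hM₁)
      (AlphaInputsT3AC.four_pi_le_C68_of_sizes (𝔠 := 𝔠) hB₃ hC) (hD6C γ hγ hγ1 K))
    hrows

/-- ★★ **LANE B's LOCALISED SCHEMA FROM [7] THEOREM 1, (D6L-CHARGED), THE PRINT-STRENGTH DATA ROW (O″), AND SIZES IN CLOSED FORM (incl. `7L + 3 ≤ M₁`)** — lane A's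
`dataSchemaT3AC_of_pinnedRows₂` over the localised class, the uncharged half of the non-emptiness row discharged by `…CoreNonemptyE`.
[cite: Balaban1985Variational, Thm 1 (6)–(8) pp.278–279; Balaban1985UV3, (40)–(42) p.266, (68) p.273 and Thm 2 p.272] -/
theorem AlphaInputsT3AC.dataSchemaT3ACL_of_pinnedRows₂C {a₀ a₁ : ℝ}
    (hT : Thm1GlobalMinAt F.L a₀ a₁ 𝔠.B₃) (ha₁ : 0 < a₁) (hwin : 𝔠.B₃ * a₁ ≤ a₀)
    (hA3 : (143 * ((((3 + 4 : ℕ) : ℝ)) ^ 2 / 4) ^ 2) * (2 * (𝔠.B₃ * a₁)) ≤ 1 / 3)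
    (hA2 : 2 * (2 * (𝔠.B₃ * a₁)) ≤ 2 * deltaSU (Fin 2) / (((3 + 4) * F.L : ℕ) : ℝ) ^ 2)
    (hB₃ : 1 ≤ 2 * 𝔠.B₃) (hC : 4 * 𝔠.B₃ * (F.L : ℝ) ^ 2 * avgWindowFactor F.L ≤ 𝔠.C68)
    (hCe : Real.exp (𝔠.p₀ - 1) ≤ 3 * C0 3 * 𝔠.C68 * (𝔠.b₀ * Q0 𝔠.p₀))
    (hCa : (𝔠.b₀ * Q0 𝔠.p₀) * (2 * (F.L : ℝ) ^ 2 * avgWindowFactor F.L) ^ 2 ≤ 3 * C0 3 * 𝔠.C68 * a₁ ^ 2)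
    (hM₁ : 7 * F.L + 3 ≤ 𝔠.M₁)
    (hD6C : ∀ (γ : ℝ) (hγ : 0 < γ) (hγ1 : γ ≤ (min 𝔠.gamma0 1) ^ 2) (K : ℕ),
      (∀ (k : ℕ), k ≤ K → ∀ (h : Hist (F.P K) k),
        Hist.Admissible 𝔠.lane.carrier.M₁ (rcolOf (T3Scales F γ hγ (hγ1.trans (sq_min_one_le _ 𝔠.gamma0_pos)) K) 𝔠.lane.carrier) k h →
        h ≠ Hist.triv (F.P K) k → ∀ (W : GaugeField (F.P K) k (Matrix.specialUnitaryGroup (Fin 2) ℂ)),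
          ChargedT3 F γ 𝔠.b₀ 𝔠.p₀ (avgWindowFactor F.L) K 𝔠.lane.carrier.M₁
            (rcolOf (T3Scales F γ hγ (hγ1.trans (sq_min_one_le _ 𝔠.gamma0_pos)) K) 𝔠.lane.carrier) k h W →
          (AlphaInputsT3AC.adaptedClassT3L F 𝔠 γ hγ hγ1 K k h W).Nonempty))
    (hrows : ∀ (γ : ℝ) (hγ : 0 < γ) (hγ1 : γ ≤ (min 𝔠.gamma0 1) ^ 2) (K : ℕ),
      (∃ Ut : (k : ℕ) → GaugeField (F.P K) k (Matrix.specialUnitaryGroup (Fin 2) ℂ) → GaugeField (F.P K) 0 (Matrix.specialUnitaryGroup (Fin 2) ℂ),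
        AlphaInputsT3AC.TrivMinimiserRowsT3 F 𝔠 γ hγ hγ1 a₀ a₁ K Ut) →
      ∃ Ut : (k : ℕ) → GaugeField (F.P K) k (Matrix.specialUnitaryGroup (Fin 2) ℂ) → GaugeField (F.P K) 0 (Matrix.specialUnitaryGroup (Fin 2) ℂ),
        AlphaInputsT3AC.TrivMinimiserRowsT3 F 𝔠 γ hγ hγ1 a₀ a₁ K Ut ∧ AlphaInputsT3AC.DataRowsT3L F 𝔠 γ hγ hγ1 K Ut) :
    DataSchemaT3ACL F 𝔠 a₀ a₁ := by
  have hL1 : 1 ≤ F.L := by have := F.hL.2; omega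
  have hanti := MinimiserPin.anti_of_C68 𝔠 hCe
  have hsmall := MinimiserPin.small_of_C68 𝔠 hL1 ha₁ (avgWindowFactor_pos F) hCa
  have hπ : 4 * Real.pi ≤ 𝔠.C68 := AlphaInputsT3AC.four_pi_le_C68_of_sizes (𝔠 := 𝔠) hB₃ hC
  intro γ hγ hγ1 K
  have hγ1' : γ ≤ 1 := hγ1.trans (sq_min_one_le _ 𝔠.gamma0_pos)
  have hγe : Real.sqrt γ ≤ Real.exp (1 - 𝔠.p₀) := (sqrt_le_exp_iff hγ.le).mpr (hγ1.trans hanti)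
  have hw0 : 0 ≤ (F.L : ℝ) ^ 2 * avgWindowFactor F.L := by
    have := avgWindowFactor_pos F
    positivity
  have hC2 : 2 * (F.L : ℝ) ^ 2 * avgWindowFactor F.L ≤ 𝔠.C68 := by nlinarith
  refine ⟨MinimiserPin.windowIneqT3_of_le F 𝔠 hγ hγ1' hγe hC2 K,
    AlphaInputsT3AC.adaptedClassNonemptyT3L_of_charged_of_collar (AlphaInputsT3AC.collarE_T3_of_M₁_ge (hγ := hγ) (hγ1 := hγ1) (K := K) hM₁) hπ (hD6C γ hγ hγ1 K),
    hrows γ hγ hγ1 K ?_⟩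
  exact AlphaInputsT3AC.trivMinimiserRowsT3_of_thm1GlobalMinAt F 𝔠 γ hγ hγ1 K hT hwin hA3 hA2 hB₃
    (fun k _ => hsmall γ hγ hγ1 K k)
    (fun k i hik hkK => MinimiserPin.C68_dom_of_le hL1 hγ hγ1' hγe 𝔠.b₀_pos 𝔠.p₀_pos.le (avgWindowFactor_pos F).le
      𝔠.B₃_pos.le hC K k i hik hkK)

/-- ★★ **THE v3 (α) PACKAGE FROM THE SAME** (through `ofV3At_of_dataSchemaT3L`). [cite: Balaban1985UV3, Thm 2 p.272; Balaban1985Variational, Thm 1 (8) p.279] -/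
theorem AlphaInputsT3AC.ofV3At_of_pinnedRows₂C {a₀ a₁ : ℝ}
    (hT : Thm1GlobalMinAt F.L a₀ a₁ 𝔠.B₃) (ha₁ : 0 < a₁) (hwin : 𝔠.B₃ * a₁ ≤ a₀)
    (hA3 : (143 * ((((3 + 4 : ℕ) : ℝ)) ^ 2 / 4) ^ 2) * (2 * (𝔠.B₃ * a₁)) ≤ 1 / 3)
    (hA2 : 2 * (2 * (𝔠.B₃ * a₁)) ≤ 2 * deltaSU (Fin 2) / (((3 + 4) * F.L : ℕ) : ℝ) ^ 2)
    (hB₃ : 1 ≤ 2 * 𝔠.B₃) (hC : 4 * 𝔠.B₃ * (F.L : ℝ) ^ 2 * avgWindowFactor F.L ≤ 𝔠.C68)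
    (hCe : Real.exp (𝔠.p₀ - 1) ≤ 3 * C0 3 * 𝔠.C68 * (𝔠.b₀ * Q0 𝔠.p₀))
    (hCa : (𝔠.b₀ * Q0 𝔠.p₀) * (2 * (F.L : ℝ) ^ 2 * avgWindowFactor F.L) ^ 2 ≤ 3 * C0 3 * 𝔠.C68 * a₁ ^ 2)
    (hM₁ : 7 * F.L + 3 ≤ 𝔠.M₁)
    (hD6C : ∀ (γ : ℝ) (hγ : 0 < γ) (hγ1 : γ ≤ (min 𝔠.gamma0 1) ^ 2) (K : ℕ),
      (∀ (k : ℕ), k ≤ K → ∀ (h : Hist (F.P K) k),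
        Hist.Admissible 𝔠.lane.carrier.M₁ (rcolOf (T3Scales F γ hγ (hγ1.trans (sq_min_one_le _ 𝔠.gamma0_pos)) K) 𝔠.lane.carrier) k h →
        h ≠ Hist.triv (F.P K) k → ∀ (W : GaugeField (F.P K) k (Matrix.specialUnitaryGroup (Fin 2) ℂ)),
          ChargedT3 F γ 𝔠.b₀ 𝔠.p₀ (avgWindowFactor F.L) K 𝔠.lane.carrier.M₁
            (rcolOf (T3Scales F γ hγ (hγ1.trans (sq_min_one_le _ 𝔠.gamma0_pos)) K) 𝔠.lane.carrier) k h W →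
          (AlphaInputsT3AC.adaptedClassT3L F 𝔠 γ hγ hγ1 K k h W).Nonempty))
    (hrows : ∀ (γ : ℝ) (hγ : 0 < γ) (hγ1 : γ ≤ (min 𝔠.gamma0 1) ^ 2) (K : ℕ),
      (∃ Ut : (k : ℕ) → GaugeField (F.P K) k (Matrix.specialUnitaryGroup (Fin 2) ℂ) → GaugeField (F.P K) 0 (Matrix.specialUnitaryGroup (Fin 2) ℂ),
        AlphaInputsT3AC.TrivMinimiserRowsT3 F 𝔠 γ hγ hγ1 a₀ a₁ K Ut) →
      ∃ Ut : (k : ℕ) → GaugeField (F.P K) k (Matrix.specialUnitaryGroup (Fin 2) ℂ) → GaugeField (F.P K) 0 (Matrix.specialUnitaryGroup (Fin 2) ℂ),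
        AlphaInputsT3AC.TrivMinimiserRowsT3 F 𝔠 γ hγ hγ1 a₀ a₁ K Ut ∧ AlphaInputsT3AC.DataRowsT3L F 𝔠 γ hγ hγ1 K Ut) :
    AlphaInputsT3AC.OfV3At F 𝔠 a₀ a₁ :=
  AlphaInputsT3AC.ofV3At_of_dataSchemaT3L
    (AlphaInputsT3AC.dataSchemaT3ACL_of_pinnedRows₂C F 𝔠 hT ha₁ hwin hA3 hA2 hB₃ hC hCe hCa hM₁ hD6C hrows)

end Knit

/-! ## §3 The attainability of the new size row -/

section Record

/-- ★ **RECORDS WITH EXACT PROFILE, ALL THREE `C68`-SIZES AND `7L + 3 ≤ M₁` EXIST BEYOND A THRESHOLD.**  For every record `𝔠₀` and every `a₁ > 0` there is `b₁` such that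
for all `b₀ ≥ b₁`, `p₀ ≥ 3` there is a record `𝔠` with `𝔠.b₀ = b₀`, `𝔠.p₀ = p₀`, `𝔠.B₃ = 𝔠₀.B₃`, the three `C68`-sizes and `7L + 3 ≤ 𝔠.M₁` (lane A's `exists_record_sizes`
run from the seed `{𝔠₀ with M₁ := max 𝔠₀.M₁ (7L + 3)}`, whose `M₁` alpha-2's `exists_alphaConsts_profile` keeps) — the new size row costs the data provider nothing.
[cite: Balaban1985UV3, (7) p.257 and (68) p.273 (bookkeeping)] -/
theorem AlphaInputsT3AC.exists_record_sizes_M₁ {L N : ℕ} (𝔠₀ : AlphaConsts L N) {a₁ : ℝ} (ha₁ : 0 < a₁) :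
    ∃ b₁ : ℝ, 0 ≤ b₁ ∧ ∀ (b₀ p₀ : ℝ), b₁ ≤ b₀ → 3 ≤ p₀ →
      ∃ 𝔠 : AlphaConsts L N, 𝔠.b₀ = b₀ ∧ 𝔠.p₀ = p₀ ∧ 𝔠.B₃ = 𝔠₀.B₃ ∧
        4 * 𝔠.B₃ * (L : ℝ) ^ 2 * avgWindowFactor L ≤ 𝔠.C68 ∧
        Real.exp (𝔠.p₀ - 1) ≤ 3 * C0 3 * 𝔠.C68 * (𝔠.b₀ * Q0 𝔠.p₀) ∧
        (𝔠.b₀ * Q0 𝔠.p₀) * (2 * (L : ℝ) ^ 2 * avgWindowFactor L) ^ 2 ≤ 3 * C0 3 * 𝔠.C68 * a₁ ^ 2 ∧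
        7 * L + 3 ≤ 𝔠.M₁ := by
  -- the seed with the big block enlarged
  let 𝔠₁ : AlphaConsts L N := { 𝔠₀ with M₁ := max 𝔠₀.M₁ (7 * L + 3), M₁_pos := lt_max_of_lt_left 𝔠₀.M₁_pos }
  have hM₁ : 7 * L + 3 ≤ 𝔠₁.M₁ := le_max_right _ _
  have hB₁ : 𝔠₁.B₃ = 𝔠₀.B₃ := rfl
  obtain ⟨b₁, hb₁, h⟩ := AlphaInputsT3AC.exists_alphaConsts_profile 𝔠₁
  refine ⟨b₁, hb₁, fun b₀ p₀ hb hp => ?_⟩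
  obtain ⟨𝔠, h1, h2, hc, -, hB, hM, -⟩ := h b₀ p₀
    (max (4 * 𝔠₀.B₃ * (L : ℝ) ^ 2 * avgWindowFactor L)
      (max (Real.exp (p₀ - 1) / (3 * C0 3 * (b₀ * Q0 p₀)))
        ((b₀ * Q0 p₀) * (2 * (L : ℝ) ^ 2 * avgWindowFactor L) ^ 2 / (3 * C0 3 * a₁ ^ 2)))) hb hp
  have hb0 : 0 < b₀ := h1 ▸ 𝔠.b₀_pos
  have hp0 : 0 < p₀ := h2 ▸ 𝔠.p₀_pos
  obtain ⟨s1, s2, s3⟩ := MinimiserPin.sizes_of_C68_ge (B₃ := 𝔠₀.B₃) (B := avgWindowFactor L) ha₁ hb0 hp0 hc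
  refine ⟨𝔠, h1, h2, hB.trans hB₁, ?_, ?_, ?_, ?_⟩
  · rw [hB, hB₁]; exact s1
  · rw [h1, h2]; exact s2
  · rw [h1, h2]; exact s3
  · rw [hM]; exact hM₁

end Record

end Summit.QuantumFields.YangMills.Theorems

end
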